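import Literature.NumberTheory.Transcendental.SemistabilityStdOfEngine
import Literature.NumberTheory.Transcendental.AnalyticSubgroupHyperplane
import HarnessLib

/-!
# The Semistability Theorem for `M_κ` is equivalent to its hyperplane case (all algebraic points)

Topic: `Literature/NumberTheory/Transcendental`. A proofs-only file (theorems only, no
definitions, no named facts) of the unit
`provefact-Literature.NumberTheory.Transcendental.s-efcbe22610` (fact
`Literature.NumberTheory.Transcendental.semistabilityTheorem_std`: Baker–Wüstholz,
*Logarithmic Forms and Diophantine Geometry*, Thm. 6.15, for the explicit group varieties
`M_κ = 𝔾ₘ^β × P_κ`, every proper semistable `ℚ̄`-rational `𝔟`, at every algebraic point).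

`AnalyticSubgroupHyperplane.lean` proves `semistabilityTheorem_std.hyperplane`: the named fact
implies its HYPERPLANE case (Thm. 6.15 for the `ℚ̄`-rational hyperplanes `W ⊆ Lie M_κ` containing
no non-zero algebraic Lie subalgebra, at all algebraic points; the explicit hypothesis `hstd`
there, which already suffices for `analyticSubgroupTheorem_GaGmE`). Here we prove the CONVERSE,
so that the named fact is exactly its hyperplane case:

* `GaGmE.Std.exists_tangent_le_of_hyperplane` — **Wüstholz's analytic subgroup theorem for
  `M_κ` from the hyperplane case**: for a `ℚ̄`-rational `𝔟 ⊆ Lie M_κ` and `w ∈ 𝔟` with `exp(w)`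
  algebraic there is a connected algebraic subgroup `K = H_{(A,C,Ξ)}` with `w ∈ Lie K ⊆ 𝔟`
  (Baker–Wüstholz Thm. 6.1 for `M_κ`). Proof (the passage to quotients of op. cit. p. 115 and the
  division points `u/n` of Huber–Wüstholz, Thm. 6.2, run over hyperplanes): by descending
  induction on an algebraic `𝔨 ∋ w`; if `𝔨 ⊄ 𝔟`, choose a `ℚ̄`-hyperplane `W ⊇ 𝔟` with `𝔨 ⊄ W`
  (`LiePresentation.exists_hyperplane_not_le`) and the largest connected algebraic `K₀` with
  `Lie K₀ ⊆ W` (`exists_max_datum`: algebraic subalgebras inside `W` are closed under sums,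
  `SubgroupData.exists_tangent_eq_sup`); the image of `W` in `Lie(M_κ/K₀) = Lie M_κ'`
  (`StdQuotients.QuotData`) is a `ℚ̄`-hyperplane without non-zero algebraic Lie subalgebra, so
  the hyperplane case at the division points `w/m` (algebraic, `inv_natCast_smul_mem_Alg`) gives
  `w ∈ m·(ker + Lie K₀)` for all `m ≥ 1`, whence `w ∈ Lie K₀` by discreteness
  (`SubgroupData.mem_tangent_of_forall_exists`), and `𝔨 ∩ Lie K₀ ∋ w` is a smaller algebraic
  subalgebra (`SubgroupData.exists_tangent_eq_inf`);
* `semistabilityTheorem_std_of_hyperplane` — **the hyperplane case implies the named fact**: a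
  proper semistable `𝔟` contains no non-zero algebraic Lie subalgebra
  (`Semistable.finrank_eq_zero_of_le`), so `w = 0 ∈ ker`;
* `semistabilityTheorem_std_iff_hyperplane`, and the corollaries
  `semistabilityTheorem_std.exists_tangent_le` (Thm. 6.1 for `M_κ` from the named fact) and
  `semistabilityTheorem_std.exists_tangent_le_GaGmE` (Thm. 6.1 for `G = 𝔾ₐ × 𝔾ₘ^ι × (E♮)^κ`).

Consequently a discharge of `semistabilityTheorem_std` needs Baker's method only for hyperplanes
`W` without non-zero algebraic Lie subalgebras (compare `SemistabilityStdOfEngine.lean`, which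
reduces the named fact to Philippon's zero estimate and the engine output for all semistable `𝔟`).

Linear algebra proved on the way (`namespace LiePresentation`, fields `K ⊆ L`):
`exists_hyperplane_not_le` (a `K`-rational subspace not containing a `K`-rational `𝔨` lies in a
`K`-rational hyperplane not containing `𝔨`), `dotAnn_span_ofK_inf` (the annihilator in `L^σ` of
an intersection of `K`-subspaces of `K^σ` is the sum of the annihilators — flat base change).

## References

* A. Baker, G. Wüstholz, *Logarithmic Forms and Diophantine Geometry*, New Math. Monogr. 9, CUP
  2007: Thm. 6.1 (p. 109), §6.7 (index, semistability), Thm. 6.15 and §6.8 (p. 115: passage to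
  the quotient `G → G^*` and to `B ∩ ker π`). [BakerWustholz2007]
* A. Huber, G. Wüstholz, *Transcendence and Linear Relations of 1-Periods*, Cambridge Tracts 227,
  CUP 2022: Thm. 6.2 and its proof (torsion points `u/n` in the quotient). [HuberWustholz2022]
-/

noncomputable section

open Module Submodule Complex

namespace Literature.NumberTheory.Transcendental

/-! ### Linear algebra over `K ⊆ L` -/

namespace LiePresentation

variable (K : Type*) {L : Type*} [Field K] [Field L] [Algebra K L] {σ : Type*} [Fintype σ]

/-- **A `K`-rational subspace lies in a `K`-rational hyperplane avoiding a given `K`-rational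
subspace not contained in it.** [folklore] -/
theorem exists_hyperplane_not_le {U V : Submodule L (σ → L)} (hU : IsKRational K U)
    (hV : IsKRational K V) (hVU : ¬ V ≤ U) :
    ∃ W : Submodule L (σ → L), IsKRational K W ∧ U ≤ W ∧
      Module.finrank L W + 1 = Fintype.card σ ∧ ¬ V ≤ W := by
  classical
  -- a `K`-point of `V` outside `U`
  obtain ⟨v, hvV, hvU⟩ : ∃ v : σ → K, ofK K (L := L) v ∈ V ∧ ofK K (L := L) v ∉ U := by
    by_contra hno
    push Not at hno
    apply hVU
    rw [hV.eq_span_kPoints (K := K)]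
    refine span_le.mpr ?_
    rintro _ ⟨v, hv, rfl⟩
    exact hno v hv
  have hvUK : v ∉ kPoints K U := hvU
  -- a `K`-linear form killing `kPoints U` but not `v`
  obtain ⟨f, hfv, hfU⟩ := Submodule.exists_dual_map_eq_bot_of_notMem hvUK Module.Projective.of_free
  set WK : Submodule K (σ → K) := LinearMap.ker f with hWK
  have hUW : kPoints K U ≤ WK := by
    intro u hu
    rw [hWK, LinearMap.mem_ker]
    have : f u ∈ (kPoints K U).map f := Submodule.mem_map_of_mem hu
    rw [hfU, Submodule.mem_bot] at this
    exact this
  -- its kernel is a hyperplane of `K^σ`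
  have hrange : LinearMap.range f = ⊤ := by
    rw [eq_top_iff]
    rintro c -
    refine ⟨(c / f v) • v, ?_⟩
    rw [map_smul, smul_eq_mul, div_mul_cancel₀ c hfv]
  have hdimK : Module.finrank K WK + 1 = Fintype.card σ := by
    have h1 := LinearMap.finrank_range_add_finrank_ker f
    rw [hrange, finrank_top, Module.finrank_self, Module.finrank_fintype_fun_eq_card] at h1
    rw [hWK]; omega
  refine ⟨span L (ofK K '' (WK : Set (σ → K))), isKRational_span_ofK K _, ?_, ?_, ?_⟩
  · rw [hU.eq_span_kPoints (K := K)]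
    exact span_mono (Set.image_mono hUW)
  · rw [finrank_span_ofK]; exact hdimK
  · intro hle
    have hvW : ofK K (L := L) v ∈ span L (ofK K '' (WK : Set (σ → K))) := hle hvV
    have : v ∈ kPoints K (span L (ofK K (L := L) '' (WK : Set (σ → K)))) := hvW
    rw [kPoints_span_ofK, span_eq, hWK, LinearMap.mem_ker] at this
    exact hfv this

/-- Membership in the annihilator `(span_L V)^⊥ ⊆ L^σ` (dot product) of a `K`-subspace
`V ≤ K^σ`: orthogonality to the vectors of `V`. [folklore] -/
theorem mem_dotAnn_span_ofK {V : Submodule K (σ → K)} {u : σ → L} :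
    u ∈ dotAnn (span L (ofK K (L := L) '' (V : Set (σ → K)))) ↔
      ∀ v ∈ V, ∑ i, algebraMap K L (v i) * u i = 0 := by
  rw [mem_dotAnn]
  constructor
  · intro h v hv
    have := h (ofK K v) (subset_span ⟨v, hv, rfl⟩)
    simpa [ofK_apply] using this
  · intro h θ hθ
    induction hθ using Submodule.span_induction with
    | mem x hx =>
      obtain ⟨v, hv, rfl⟩ := hx
      simpa [ofK_apply] using h v hv
    | zero => simp
    | add x y _ _ hx hy =>
      simp only [Pi.add_apply, add_mul, Finset.sum_add_distrib, hx, hy, add_zero]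
    | smul c x _ hx =>
      simp only [Pi.smul_apply, smul_eq_mul, mul_assoc, ← Finset.mul_sum, hx, mul_zero]

/-- The annihilator is antitone in `V`. [folklore] -/
theorem dotAnn_span_ofK_anti {V V' : Submodule K (σ → K)} (h : V ≤ V') :
    dotAnn (span L (ofK K (L := L) '' (V' : Set (σ → K)))) ≤ dotAnn (span L (ofK K (L := L) '' (V : Set (σ → K)))) := by
  intro u hu
  rw [mem_dotAnn_span_ofK] at hu ⊢
  exact fun v hv => hu v (h hv)

/-- `dim (span_L V)^⊥ + dim_K V = |σ|`. [folklore] -/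
theorem finrank_dotAnn_span_ofK_add (V : Submodule K (σ → K)) :
    Module.finrank L (dotAnn (span L (ofK K (L := L) '' (V : Set (σ → K))))) + Module.finrank K V =
      Fintype.card σ := by
  rw [← finrank_span_ofK K (L := L) V]
  exact finrank_dotAnn_add _

/-- `(span V)^⊥ ⊓ (span V')^⊥ ≤ (span (V ⊔ V'))^⊥`. [folklore] -/
theorem dotAnn_span_ofK_inf_le (V V' : Submodule K (σ → K)) :
    dotAnn (span L (ofK K (L := L) '' (V : Set (σ → K)))) ⊓ dotAnn (span L (ofK K (L := L) '' (V' : Set (σ → K)))) ≤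
      dotAnn (span L (ofK K (L := L) '' ((V ⊔ V' : Submodule K (σ → K)) : Set (σ → K)))) := by
  intro u hu
  rw [Submodule.mem_inf, mem_dotAnn_span_ofK, mem_dotAnn_span_ofK] at hu
  rw [mem_dotAnn_span_ofK]
  intro v hv
  obtain ⟨a, ha, b, hb, rfl⟩ := Submodule.mem_sup.mp hv
  simp only [Pi.add_apply, map_add, add_mul, Finset.sum_add_distrib, hu.1 a ha, hu.2 b hb, add_zero]

/-- **The annihilator of an intersection of `K`-subspaces is the sum of the annihilators** (base
change from `K` to `L` is exact: `(span_L (V ∩ V'))^⊥ = (span_L V)^⊥ + (span_L V')^⊥`).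
[folklore] -/
theorem dotAnn_span_ofK_inf (V V' : Submodule K (σ → K)) :
    dotAnn (span L (ofK K (L := L) '' ((V ⊓ V' : Submodule K (σ → K)) : Set (σ → K)))) =
      dotAnn (span L (ofK K (L := L) '' (V : Set (σ → K)))) ⊔ dotAnn (span L (ofK K (L := L) '' (V' : Set (σ → K)))) := by
  symm
  refine Submodule.eq_of_le_of_finrank_le
    (sup_le (dotAnn_span_ofK_anti K inf_le_left) (dotAnn_span_ofK_anti K inf_le_right)) ?_
  -- dimension count
  have h1 := finrank_dotAnn_span_ofK_add K (L := L) V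
  have h2 := finrank_dotAnn_span_ofK_add K (L := L) V'
  have h3 := finrank_dotAnn_span_ofK_add K (L := L) (V ⊓ V')
  have h4 := finrank_dotAnn_span_ofK_add K (L := L) (V ⊔ V')
  have h5 := Submodule.finrank_sup_add_finrank_inf_eq (dotAnn (span L (ofK K (L := L) '' (V : Set (σ → K)))))
    (dotAnn (span L (ofK K (L := L) '' (V' : Set (σ → K)))))
  have h6 := Submodule.finrank_sup_add_finrank_inf_eq V V'
  have h7 := Submodule.finrank_mono (dotAnn_span_ofK_inf_le K (L := L) V V')
  omega

end LiePresentation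

namespace GaGmE

namespace Std

open LiePresentation

variable {β γ δ : Type} [Fintype β] [Fintype γ] [Fintype δ] {κM : δ → γ → Kbar}

/-! ### Subgroup data: the whole group, the trivial subgroup, intersections and sums -/

variable (κM) in
/-- The whole group `M_κ` is a connected algebraic subgroup (`A = 0`, `C = 0`, `Ξ = 0`):
`⊤ = Lie M_κ` is an algebraic Lie subalgebra. [folklore] -/
theorem exists_subgroupData_tangent_eq_top : ∃ D : SubgroupData β γ δ κM, D.tangent = ⊤ := by
  refine ⟨⟨⊥, ⊥, ⊥, ?_⟩, ?_⟩
  · intro ξ hξ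
    rw [Submodule.mem_bot] at hξ
    subst hξ
    simp
  · rw [eq_top_iff]
    intro w _
    rw [SubgroupData.mem_tangent_iff]
    refine ⟨fun q hq => ?_, fun c hc => ?_, fun ξ hξ => ?_⟩
    · change q ∈ (⊥ : Submodule ℚ (β → ℚ)) at hq
      rw [Submodule.mem_bot] at hq; subst hq; simp
    · change c ∈ (⊥ : Submodule ℚ (γ → ℚ)) at hc
      rw [Submodule.mem_bot] at hc; subst hc; simp
    · change ξ ∈ (⊥ : Submodule Kbar (δ → Kbar)) at hξ
      rw [Submodule.mem_bot] at hξ; subst hξ; simp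

variable (κM) in
/-- The trivial subgroup `0 ≤ M_κ` (`A`, `C`, `Ξ` everything): `⊥` is an algebraic Lie
subalgebra. [folklore] -/
theorem exists_subgroupData_tangent_eq_bot : ∃ D : SubgroupData β γ δ κM, D.tangent = ⊥ := by
  classical
  refine ⟨⟨⊤, ⊤, ⊤, ?_⟩, ?_⟩
  · intro ξ _
    have : (fun b => ∑ e, ξ e * κM e b) =
        ∑ b, (∑ e, ξ e * κM e b) • (fun b' => ((Pi.single b 1 : γ → ℚ) b' : Kbar)) := by
      funext b'
      simp only [Finset.sum_apply, Pi.smul_apply, smul_eq_mul, Pi.single_apply]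
      rw [Finset.sum_eq_single b']
      · simp
      · intro b _ hb; simp [Ne.symm hb]
      · intro h; exact absurd (Finset.mem_univ _) h
    rw [this]
    refine Submodule.sum_mem _ fun b _ => Submodule.smul_mem _ _ (Submodule.subset_span ?_)
    exact ⟨Pi.single b 1, Submodule.mem_top, rfl⟩
  · rw [eq_bot_iff]
    intro w hw
    rw [SubgroupData.mem_tangent_iff] at hw
    obtain ⟨hA, hC, hΞ⟩ := hw
    rw [Submodule.mem_bot]
    funext s
    rcases s with j | b | e
    · have := hA (Pi.single j 1) Submodule.mem_top
      show w (iy j) = 0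
      rw [Finset.sum_eq_single j (fun x _ hx => by simp [Pi.single_eq_of_ne hx])
        (fun h => absurd (Finset.mem_univ j) h)] at this
      simpa using this
    · have := hC (Pi.single b 1) Submodule.mem_top
      show w (iz b) = 0
      rw [Finset.sum_eq_single b (fun x _ hx => by simp [Pi.single_eq_of_ne hx])
        (fun h => absurd (Finset.mem_univ b) h)] at this
      simpa using this
    · have := hΞ (Pi.single e 1) Submodule.mem_top
      show w (is e) = 0
      rw [Finset.sum_eq_single e (fun x _ hx => by simp [Pi.single_eq_of_ne hx])
        (fun h => absurd (Finset.mem_univ e) h)] at this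
      simpa using this

namespace SubgroupData

omit [Fintype β] [Fintype γ] [Fintype δ] in
/-- The span used in the compatibility condition is the `ℚ̄`-span of `ofK ℚ '' C` (the two
coercions `ℚ → ℚ̄` agree definitionally). [folklore] -/
theorem span_image_eq (C : Submodule ℚ (γ → ℚ)) :
    Submodule.span Kbar ((fun c : γ → ℚ => fun b => (c b : Kbar)) '' (C : Set (γ → ℚ))) =
      Submodule.span Kbar (ofK ℚ (L := Kbar) '' (C : Set (γ → ℚ))) := by
  congr 1

/-- **Intersection of connected algebraic subgroups** (connected component of `K₁ ∩ K₂`: the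
datum `(A₁ + A₂, C₁ + C₂, Ξ₁ + Ξ₂)`): `Lie K₁ ∩ Lie K₂` is an algebraic Lie subalgebra.
[folklore] -/
theorem exists_tangent_eq_inf (D₁ D₂ : SubgroupData β γ δ κM) :
    ∃ D : SubgroupData β γ δ κM, D.tangent = D₁.tangent ⊓ D₂.tangent := by
  refine ⟨⟨D₁.A ⊔ D₂.A, D₁.C ⊔ D₂.C, D₁.Ξ ⊔ D₂.Ξ, ?_⟩, ?_⟩
  · intro ξ hξ
    obtain ⟨ξ₁, h₁, ξ₂, h₂, rfl⟩ := Submodule.mem_sup.mp hξ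
    have e : (fun b => ∑ e, (ξ₁ + ξ₂) e * κM e b) =
        (fun b => ∑ e, ξ₁ e * κM e b) + fun b => ∑ e, ξ₂ e * κM e b := by
      funext b
      simp only [Pi.add_apply, add_mul, Finset.sum_add_distrib]
    rw [e]
    refine Submodule.add_mem _ ?_ ?_
    · exact Submodule.span_mono (Set.image_mono fun c hc => Submodule.mem_sup_left hc) (D₁.compat ξ₁ h₁)
    · exact Submodule.span_mono (Set.image_mono fun c hc => Submodule.mem_sup_right hc) (D₂.compat ξ₂ h₂)
  · ext w
    rw [Submodule.mem_inf, mem_tangent_iff, mem_tangent_iff, mem_tangent_iff]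
    constructor
    · rintro ⟨hA, hC, hΞ⟩
      exact ⟨⟨fun q hq => hA q (Submodule.mem_sup_left hq), fun c hc => hC c (Submodule.mem_sup_left hc),
          fun ξ hξ => hΞ ξ (Submodule.mem_sup_left hξ)⟩,
        ⟨fun q hq => hA q (Submodule.mem_sup_right hq), fun c hc => hC c (Submodule.mem_sup_right hc),
          fun ξ hξ => hΞ ξ (Submodule.mem_sup_right hξ)⟩⟩
    · rintro ⟨⟨hA₁, hC₁, hΞ₁⟩, ⟨hA₂, hC₂, hΞ₂⟩⟩
      refine ⟨fun q hq => ?_, fun c hc => ?_, fun ξ hξ => ?_⟩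
      · obtain ⟨q₁, h₁, q₂, h₂, rfl⟩ := Submodule.mem_sup.mp hq
        simp only [Pi.add_apply, Rat.cast_add, add_mul, Finset.sum_add_distrib, hA₁ q₁ h₁, hA₂ q₂ h₂,
          add_zero]
      · obtain ⟨c₁, h₁, c₂, h₂, rfl⟩ := Submodule.mem_sup.mp hc
        simp only [Pi.add_apply, Rat.cast_add, add_mul, Finset.sum_add_distrib, hC₁ c₁ h₁, hC₂ c₂ h₂,
          add_zero]
      · obtain ⟨ξ₁, h₁, ξ₂, h₂, rfl⟩ := Submodule.mem_sup.mp hξ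
        simp only [Pi.add_apply, AddMemClass.coe_add, add_mul, Finset.sum_add_distrib, hΞ₁ ξ₁ h₁,
          hΞ₂ ξ₂ h₂, add_zero]

/-- A vector supported on the `y`-block lies in `Lie K` iff the `A`-forms kill it. [folklore] -/
theorem coords_y_mem_tangent (D : SubgroupData β γ δ κM) {y : β → ℂ}
    (hy : ∀ q ∈ D.A, ∑ j, (q j : ℂ) * y j = 0) :
    coords y (fun _ : γ => (0 : ℂ)) (fun _ : δ => (0 : ℂ)) ∈ D.tangent := by
  rw [mem_tangent_iff]
  exact ⟨fun q hq => by simpa using hy q hq, fun c _ => by simp, fun ξ _ => by simp⟩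

/-- A vector supported on the `z`-block lies in `Lie K` iff the `C`-forms kill it. [folklore] -/
theorem coords_z_mem_tangent (D : SubgroupData β γ δ κM) {z : γ → ℂ}
    (hz : ∀ c ∈ D.C, ∑ b, (c b : ℂ) * z b = 0) :
    coords (fun _ : β => (0 : ℂ)) z (fun _ : δ => (0 : ℂ)) ∈ D.tangent := by
  rw [mem_tangent_iff]
  exact ⟨fun q _ => by simp, fun c hc => by simpa using hz c hc, fun ξ _ => by simp⟩

/-- A vector supported on the `s`-block lies in `Lie K` iff the `Ξ`-forms kill it. [folklore] -/
theorem coords_s_mem_tangent (D : SubgroupData β γ δ κM) {s : δ → ℂ}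
    (hs : ∀ ξ ∈ D.Ξ, ∑ e, (ξ e : ℂ) * s e = 0) :
    coords (fun _ : β => (0 : ℂ)) (fun _ : γ => (0 : ℂ)) s ∈ D.tangent := by
  rw [mem_tangent_iff]
  exact ⟨fun q _ => by simp, fun c _ => by simp, fun ξ hξ => by simpa using hs ξ hξ⟩

/-- **The subgroup generated by two connected algebraic subgroups** (the datum
`(A₁ ∩ A₂, C₁ ∩ C₂, Ξ₁ ∩ Ξ₂)`; compatibility because `span C₁ ∩ span C₂ = span(C₁ ∩ C₂)` after
base change to `ℚ̄`): `Lie K₁ + Lie K₂` is an algebraic Lie subalgebra (blockwise,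
`(A₁ ∩ A₂)^⊥ = A₁^⊥ + A₂^⊥`, `LiePresentation.dotAnn_span_ofK_inf`). [folklore] -/
theorem exists_tangent_eq_sup (D₁ D₂ : SubgroupData β γ δ κM) :
    ∃ D : SubgroupData β γ δ κM, D.tangent = D₁.tangent ⊔ D₂.tangent := by
  refine ⟨⟨D₁.A ⊓ D₂.A, D₁.C ⊓ D₂.C, D₁.Ξ ⊓ D₂.Ξ, ?_⟩, ?_⟩
  · intro ξ hξ
    have h₁ := D₁.compat ξ hξ.1
    have h₂ := D₂.compat ξ hξ.2
    rw [span_image_eq] at h₁ h₂ ⊢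
    -- the intersection of the two `ℚ`-rational spans is the span of `C₁ ∩ C₂`
    have hrat : IsKRational ℚ (Submodule.span Kbar (ofK ℚ (L := Kbar) '' (D₁.C : Set (γ → ℚ))) ⊓
        Submodule.span Kbar (ofK ℚ (L := Kbar) '' (D₂.C : Set (γ → ℚ)))) :=
      (isKRational_span_ofK ℚ _).inf ℚ (isKRational_span_ofK ℚ _)
    have hmem : (fun b => ∑ e, ξ e * κM e b) ∈ Submodule.span Kbar (ofK ℚ (L := Kbar) '' (D₁.C : Set (γ → ℚ))) ⊓
        Submodule.span Kbar (ofK ℚ (L := Kbar) '' (D₂.C : Set (γ → ℚ))) := ⟨h₁, h₂⟩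
    rw [hrat.eq_span_kPoints (K := ℚ), kPoints_inf, kPoints_span_ofK, kPoints_span_ofK, span_eq, span_eq]
      at hmem
    exact hmem
  refine le_antisymm ?_ (sup_le ?_ ?_)
  · intro w hw
    rw [mem_tangent_iff] at hw
    obtain ⟨hA, hC, hΞ⟩ := hw
    -- the three blocks of `w`
    set y : β → ℂ := fun j => w (iy j) with hy
    set z : γ → ℂ := fun b => w (iz b) with hz
    set s : δ → ℂ := fun e => w (is e) with hs
    have hw_eq : w = coords y (fun _ => (0 : ℂ)) (fun _ => 0) + coords (fun _ => (0 : ℂ)) z (fun _ => 0) +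
        coords (fun _ => (0 : ℂ)) (fun _ => 0) s := by
      funext x
      rcases x with j | b | e
      · show w (iy j) = _; simp [coords, hy]
      · show w (iz b) = _; simp [coords, hz]
      · show w (is e) = _; simp [coords, hs]
    -- block `y`: `y ∈ (A₁ ∩ A₂)^⊥ = A₁^⊥ + A₂^⊥`; same for `z` and `s`
    have hyA : y ∈ dotAnn (span ℂ (ofK ℚ (L := ℂ) '' ((D₁.A ⊓ D₂.A : Submodule ℚ (β → ℚ)) : Set (β → ℚ)))) := by
      rw [mem_dotAnn_span_ofK]
      intro q hq
      simpa [eq_ratCast] using hA q hq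
    rw [dotAnn_span_ofK_inf] at hyA
    obtain ⟨y₁, hy₁, y₂, hy₂, hy12⟩ := Submodule.mem_sup.mp hyA
    rw [mem_dotAnn_span_ofK] at hy₁ hy₂
    have hzC : z ∈ dotAnn (span ℂ (ofK ℚ (L := ℂ) '' ((D₁.C ⊓ D₂.C : Submodule ℚ (γ → ℚ)) : Set (γ → ℚ)))) := by
      rw [mem_dotAnn_span_ofK]
      intro c hc
      simpa [eq_ratCast] using hC c hc
    rw [dotAnn_span_ofK_inf] at hzC
    obtain ⟨z₁, hz₁, z₂, hz₂, hz12⟩ := Submodule.mem_sup.mp hzC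
    rw [mem_dotAnn_span_ofK] at hz₁ hz₂
    have hsΞ : s ∈ dotAnn (span ℂ (ofK Kbar (L := ℂ) '' ((D₁.Ξ ⊓ D₂.Ξ : Submodule Kbar (δ → Kbar)) : Set (δ → Kbar)))) := by
      rw [mem_dotAnn_span_ofK]
      intro ξ hξ
      simpa using hΞ ξ hξ
    rw [dotAnn_span_ofK_inf] at hsΞ
    obtain ⟨s₁, hs₁, s₂, hs₂, hs12⟩ := Submodule.mem_sup.mp hsΞ
    rw [mem_dotAnn_span_ofK] at hs₁ hs₂
    -- reassemble
    have ey : (coords y (fun _ : γ => (0 : ℂ)) (fun _ : δ => (0 : ℂ))) =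
        coords y₁ (fun _ : γ => (0 : ℂ)) (fun _ : δ => (0 : ℂ)) +
          coords y₂ (fun _ : γ => (0 : ℂ)) (fun _ : δ => (0 : ℂ)) := by
      funext x; rcases x with j | b | e
      · show y j = y₁ j + y₂ j; rw [← hy12]; rfl
      · show (0 : ℂ) = 0 + 0; simp
      · show (0 : ℂ) = 0 + 0; simp
    have ez : (coords (fun _ : β => (0 : ℂ)) z (fun _ : δ => (0 : ℂ))) =
        coords (fun _ : β => (0 : ℂ)) z₁ (fun _ : δ => (0 : ℂ)) +
          coords (fun _ : β => (0 : ℂ)) z₂ (fun _ : δ => (0 : ℂ)) := by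
      funext x; rcases x with j | b | e
      · show (0 : ℂ) = 0 + 0; simp
      · show z b = z₁ b + z₂ b; rw [← hz12]; rfl
      · show (0 : ℂ) = 0 + 0; simp
    have es : (coords (fun _ : β => (0 : ℂ)) (fun _ : γ => (0 : ℂ)) s) =
        coords (fun _ : β => (0 : ℂ)) (fun _ : γ => (0 : ℂ)) s₁ +
          coords (fun _ : β => (0 : ℂ)) (fun _ : γ => (0 : ℂ)) s₂ := by
      funext x; rcases x with j | b | e
      · show (0 : ℂ) = 0 + 0; simp
      · show (0 : ℂ) = 0 + 0; simp
      · show s e = s₁ e + s₂ e; rw [← hs12]; rfl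
    rw [hw_eq, ey, ez, es]
    refine Submodule.add_mem _ (Submodule.add_mem _ (Submodule.add_mem _ ?_ ?_) (Submodule.add_mem _ ?_ ?_))
      (Submodule.add_mem _ ?_ ?_)
    · exact Submodule.mem_sup_left (D₁.coords_y_mem_tangent fun q hq => by simpa [eq_ratCast] using hy₁ q hq)
    · exact Submodule.mem_sup_right (D₂.coords_y_mem_tangent fun q hq => by simpa [eq_ratCast] using hy₂ q hq)
    · exact Submodule.mem_sup_left (D₁.coords_z_mem_tangent fun c hc => by simpa [eq_ratCast] using hz₁ c hc)
    · exact Submodule.mem_sup_right (D₂.coords_z_mem_tangent fun c hc => by simpa [eq_ratCast] using hz₂ c hc)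
    · exact Submodule.mem_sup_left (D₁.coords_s_mem_tangent fun ξ hξ => by simpa using hs₁ ξ hξ)
    · exact Submodule.mem_sup_right (D₂.coords_s_mem_tangent fun ξ hξ => by simpa using hs₂ ξ hξ)
  · intro w hw
    rw [mem_tangent_iff] at hw ⊢
    obtain ⟨hA, hC, hΞ⟩ := hw
    exact ⟨fun q hq => hA q hq.1, fun c hc => hC c hc.1, fun ξ hξ => hΞ ξ hξ.1⟩
  · intro w hw
    rw [mem_tangent_iff] at hw ⊢
    obtain ⟨hA, hC, hΞ⟩ := hw
    exact ⟨fun q hq => hA q hq.2, fun c hc => hC c hc.2, fun ξ hξ => hΞ ξ hξ.2⟩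

/-- `Lie K` is `ℚ̄`-rational. [folklore] -/
theorem isKRational_tangent (D : SubgroupData β γ δ κM) : IsKRational Kbar D.tangent :=
  isKRational_solSpace Kbar D.forms

end SubgroupData

/-! ### The largest connected algebraic subgroup with Lie algebra inside a subspace -/

/-- **The largest connected algebraic subgroup `K₀` with `Lie K₀ ⊆ W`**: a datum of maximal
dimension inside `W` contains all the others (sums of algebraic subalgebras are algebraic).
[folklore] -/
theorem exists_max_datum (κM : δ → γ → Kbar) (W : Submodule ℂ (β ⊕ (γ ⊕ δ) → ℂ)) :
    ∃ D₀ : SubgroupData β γ δ κM, D₀.tangent ≤ W ∧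
      ∀ D : SubgroupData β γ δ κM, D.tangent ≤ W → D.tangent ≤ D₀.tangent := by
  classical
  set n := Fintype.card (β ⊕ (γ ⊕ δ)) with hn
  let P : ℕ → Prop := fun r => ∃ D : SubgroupData β γ δ κM, D.tangent ≤ W ∧ Module.finrank ℂ D.tangent = r
  have hP0 : P 0 := by
    obtain ⟨Z, hZ⟩ := exists_subgroupData_tangent_eq_bot (β := β) κM
    exact ⟨Z, by rw [hZ]; exact bot_le, by rw [hZ, finrank_bot]⟩
  have hle : ∀ D : SubgroupData β γ δ κM, Module.finrank ℂ D.tangent ≤ n := fun D => by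
    have := Submodule.finrank_le D.tangent
    simpa [hn] using this
  obtain ⟨D₀, hD₀W, hD₀r⟩ : P (Nat.findGreatest P n) := Nat.findGreatest_spec (Nat.zero_le n) hP0
  refine ⟨D₀, hD₀W, fun D hDW => ?_⟩
  -- the sum `D₀ ⊔ D` is again inside `W`, hence not larger than `D₀`
  obtain ⟨J, hJ⟩ := D₀.exists_tangent_eq_sup D
  have hJW : J.tangent ≤ W := by
    rw [hJ]; exact sup_le hD₀W hDW
  have hJr : Module.finrank ℂ J.tangent ≤ Nat.findGreatest P n :=
    Nat.le_findGreatest (hle _) ⟨J, hJW, rfl⟩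
  have hD₀J : D₀.tangent ≤ J.tangent := by
    rw [hJ]; exact le_sup_left
  have heq : D₀.tangent = J.tangent :=
    Submodule.eq_of_le_of_finrank_le hD₀J (by rw [hD₀r]; exact hJr)
  rw [heq, hJ]
  exact le_sup_right

/-! ### From the hyperplane case to the analytic subgroup theorem -/

/-- **Key step.** Granted the hyperplane case of Thm. 6.15 for all `M_κ'` (hypothesis `h`): if
`W ⊆ Lie M_κ` is a `ℚ̄`-rational hyperplane, `K₀` the largest connected algebraic subgroup with
`Lie K₀ ⊆ W`, and `w ∈ W` has `exp(w)` algebraic, then `w ∈ Lie K₀` — the hyperplane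
`W/Lie K₀` of `Lie(M_κ/K₀)` contains no non-zero algebraic Lie subalgebra, so the images of the
division points `w/m` lie in `ker(exp_{M_κ/K₀})`, and `ker(exp_{M_κ/K₀})` is discrete.
[cite: BakerWustholz2007, §6.8 (p. 115: passage to the quotient)] [cite: HuberWustholz2022, Thm. 6.2 (proof: the points u/n)] -/
theorem mem_tangent_of_hyperplane
    (h : ∀ (L : PeriodPair), IsAlgebraic ℚ L.g₂ → IsAlgebraic ℚ L.g₃ → ¬ L.HasCM →
      ∀ (β γ δ : Type) [Fintype β] [Fintype γ] [Fintype δ] (κM : δ → γ → GaGmE.Kbar)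
        (W : Submodule ℂ (β ⊕ (γ ⊕ δ) → ℂ)), LiePresentation.IsKRational GaGmE.Kbar W →
        finrank ℂ W + 1 = Fintype.card (β ⊕ (γ ⊕ δ)) →
        (∀ 𝔨 ∈ GaGmE.Std.algLie κM, 𝔨 ≤ W → 𝔨 = ⊥) →
        ∀ w ∈ W, w ∈ GaGmE.Std.Alg L κM → w ∈ GaGmE.Std.ker L κM)
    (L : PeriodPair) (h₂ : IsAlgebraic ℚ L.g₂) (h₃ : IsAlgebraic ℚ L.g₃) (hCM : ¬ L.HasCM)
    {W : Submodule ℂ (β ⊕ (γ ⊕ δ) → ℂ)} (hWrat : IsKRational Kbar W)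
    (hW : finrank ℂ W + 1 = Fintype.card (β ⊕ (γ ⊕ δ)))
    {D₀ : SubgroupData β γ δ κM} (hD₀W : D₀.tangent ≤ W)
    (hmax : ∀ D : SubgroupData β γ δ κM, D.tangent ≤ W → D.tangent ≤ D₀.tangent)
    {w : β ⊕ (γ ⊕ δ) → ℂ} (hwW : w ∈ W) (hw : w ∈ Alg L κM) : w ∈ D₀.tangent := by
  classical
  obtain ⟨Q⟩ := nonempty_quotData D₀
  set W' : Submodule ℂ (Q.σ' → ℂ) := W.map Q.Φ with hW'
  have hcomap : W'.comap Q.Φ = W := by rw [Q.comap_map, sup_eq_left.mpr hD₀W]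
  -- (1) rationality
  have h1 : IsKRational Kbar W' := Q.isKRational_map hWrat
  -- (2) `Φ(W)` is a hyperplane
  have hdimW : finrank ℂ W = finrank ℂ W' + finrank ℂ ↥D₀.tangent := by
    rw [← hcomap]; exact Q.finrank_comap W'
  have hcard := Q.card_eq
  have h2 : finrank ℂ W' + 1 = Fintype.card Q.σ' := by omega
  -- (3) no non-zero algebraic Lie subalgebra inside `Φ(W)`
  have h3 : ∀ 𝔨' ∈ algLie Q.κM', 𝔨' ≤ W' → 𝔨' = ⊥ := by
    rintro _ ⟨D', rfl⟩ hle
    have hpullW : (Q.pull D').tangent ≤ W := by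
      rw [← Q.comap_tangent, ← hcomap]
      exact Submodule.comap_mono hle
    have heq : (Q.pull D').tangent = D₀.tangent :=
      le_antisymm (hmax _ hpullW) (Q.tangent_le_pull D')
    apply Submodule.comap_injective_of_surjective Q.Φ_surjective
    rw [Q.comap_tangent, heq, Submodule.comap_bot, Q.ker_Φ]
  -- (4) the hyperplane case at the division points `w/m`, and discreteness
  refine D₀.mem_tangent_of_forall_exists (L := L) w fun m hm => ?_
  have hwm : (m : ℂ)⁻¹ • w ∈ Alg L κM := inv_natCast_smul_mem_Alg L κM h₂ h₃ hw hm
  have hwmW : (m : ℂ)⁻¹ • w ∈ W := Submodule.smul_mem _ _ hwW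
  have h5 : Q.Φ ((m : ℂ)⁻¹ • w) ∈ ker L Q.κM' :=
    h L h₂ h₃ hCM _ _ _ Q.κM' W' h1 h2 h3 _ (Submodule.mem_map_of_mem hwmW) (Q.Φ_mem_Alg h₂ h₃ hwm)
  obtain ⟨k, hk, hh⟩ := Q.exists_ker_of_Φ_mem_ker h5
  refine ⟨k, hk, (m : ℂ)⁻¹ • w - k, hh, ?_⟩
  have hm0 : (m : ℂ) ≠ 0 := by exact_mod_cast hm.ne'
  rw [add_sub_cancel, smul_smul, mul_inv_cancel₀ hm0, one_smul]

/-- **Wüstholz's analytic subgroup theorem for `M_κ` from the hyperplane case of Thm. 6.15**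
(Baker–Wüstholz 2007, Thm. 6.1, for the explicit group varieties `M_κ = 𝔾ₘ^β × P_κ`): if
`𝔟 ⊆ Lie M_κ` is `ℚ̄`-rational and `w ∈ 𝔟_ℂ` has `exp_{M_κ}(w)` algebraic, then `w ∈ Lie K ⊆ 𝔟`
for some connected algebraic subgroup `K = H_{(A,C,Ξ)}` of `M_κ`. Proof: descending induction on
an algebraic `𝔨 ∋ w`, through `ℚ̄`-hyperplanes `W ⊇ 𝔟` with `𝔨 ⊄ W` and the key step.
[cite: BakerWustholz2007, Thm. 6.1, §6.8 (p. 115)] [cite: HuberWustholz2022, Thm. 6.2] -/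
theorem exists_tangent_le_of_hyperplane
    (h : ∀ (L : PeriodPair), IsAlgebraic ℚ L.g₂ → IsAlgebraic ℚ L.g₃ → ¬ L.HasCM →
      ∀ (β γ δ : Type) [Fintype β] [Fintype γ] [Fintype δ] (κM : δ → γ → GaGmE.Kbar)
        (W : Submodule ℂ (β ⊕ (γ ⊕ δ) → ℂ)), LiePresentation.IsKRational GaGmE.Kbar W →
        finrank ℂ W + 1 = Fintype.card (β ⊕ (γ ⊕ δ)) →
        (∀ 𝔨 ∈ GaGmE.Std.algLie κM, 𝔨 ≤ W → 𝔨 = ⊥) →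
        ∀ w ∈ W, w ∈ GaGmE.Std.Alg L κM → w ∈ GaGmE.Std.ker L κM)
    (L : PeriodPair) (h₂ : IsAlgebraic ℚ L.g₂) (h₃ : IsAlgebraic ℚ L.g₃) (hCM : ¬ L.HasCM)
    (κM : δ → γ → Kbar) {𝔟 : Submodule ℂ (β ⊕ (γ ⊕ δ) → ℂ)} (hrat : IsKRational Kbar 𝔟)
    {w : β ⊕ (γ ⊕ δ) → ℂ} (hw𝔟 : w ∈ 𝔟) (hw : w ∈ Alg L κM) :
    ∃ D : SubgroupData β γ δ κM, w ∈ D.tangent ∧ D.tangent ≤ 𝔟 := by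
  classical
  -- descending induction on the dimension of an algebraic `𝔨 ∋ w`
  suffices key : ∀ d : ℕ, ∀ D : SubgroupData β γ δ κM, Module.finrank ℂ D.tangent ≤ d →
      w ∈ D.tangent → ∃ D' : SubgroupData β γ δ κM, w ∈ D'.tangent ∧ D'.tangent ≤ 𝔟 by
    obtain ⟨T, hT⟩ := exists_subgroupData_tangent_eq_top (β := β) κM
    exact key _ T le_rfl (by rw [hT]; exact Submodule.mem_top)
  intro d
  induction d with
  | zero =>
    intro D hd hwD
    have hbot : D.tangent = ⊥ := Submodule.finrank_eq_zero.mp (Nat.le_zero.mp hd)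
    exact ⟨D, hwD, by rw [hbot]; exact bot_le⟩
  | succ d ih =>
    intro D hd hwD
    by_cases hle : D.tangent ≤ 𝔟
    · exact ⟨D, hwD, hle⟩
    -- a `ℚ̄`-hyperplane `W ⊇ 𝔟` with `Lie D ⊄ W`, and the largest algebraic `K₀` inside `W`
    obtain ⟨W, hWrat, h𝔟W, hW, hDW⟩ := exists_hyperplane_not_le Kbar hrat D.isKRational_tangent hle
    obtain ⟨D₀, hD₀W, hmax⟩ := exists_max_datum κM W
    have hwD₀ : w ∈ D₀.tangent :=
      mem_tangent_of_hyperplane h L h₂ h₃ hCM hWrat hW hD₀W hmax (h𝔟W hw𝔟) hw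
    -- `Lie D ∩ Lie K₀ ∋ w` is a smaller algebraic subalgebra
    obtain ⟨D₁, hD₁⟩ := D.exists_tangent_eq_inf D₀
    have hlt : D₁.tangent < D.tangent := by
      rw [hD₁]
      refine lt_of_le_of_ne inf_le_left fun heq => hDW ?_
      have : D.tangent ≤ D₀.tangent := by rw [← heq]; exact inf_le_right
      exact this.trans hD₀W
    have hd' : Module.finrank ℂ D₁.tangent ≤ d := by
      have := Submodule.finrank_lt_finrank_of_lt hlt
      omega
    exact ih D₁ hd' (by rw [hD₁]; exact ⟨hwD, hwD₀⟩)

end Std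

end GaGmE

open GaGmE GaGmE.Std in
/-- **The hyperplane case of the Semistability Theorem for the `M_κ` (at all algebraic points)
implies the named fact `semistabilityTheorem_std`** (every codimension): by the analytic subgroup
theorem `exists_tangent_le_of_hyperplane`, an algebraic point `exp(w)` of `B = exp(𝔟_ℂ)` has
`w ∈ Lie K ⊆ 𝔟` for a connected algebraic `K`, and a proper semistable `𝔟` contains no non-zero
algebraic Lie subalgebra (`Semistable.finrank_eq_zero_of_le`, Baker–Wüstholz §6.7), so `w = 0`.
Converse: `semistabilityTheorem_std.hyperplane` (`AnalyticSubgroupHyperplane.lean`).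
[cite: BakerWustholz2007, Thm. 6.15, §6.7, §6.8 (p. 115)] -/
theorem semistabilityTheorem_std_of_hyperplane
    (h : ∀ (L : PeriodPair), IsAlgebraic ℚ L.g₂ → IsAlgebraic ℚ L.g₃ → ¬ L.HasCM →
      ∀ (β γ δ : Type) [Fintype β] [Fintype γ] [Fintype δ] (κM : δ → γ → GaGmE.Kbar)
        (W : Submodule ℂ (β ⊕ (γ ⊕ δ) → ℂ)), LiePresentation.IsKRational GaGmE.Kbar W →
        finrank ℂ W + 1 = Fintype.card (β ⊕ (γ ⊕ δ)) →
        (∀ 𝔨 ∈ GaGmE.Std.algLie κM, 𝔨 ≤ W → 𝔨 = ⊥) →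
        ∀ w ∈ W, w ∈ GaGmE.Std.Alg L κM → w ∈ GaGmE.Std.ker L κM) :
    semistabilityTheorem_std := by
  intro L h₂ h₃ hCM β γ δ _ _ _ κM 𝔟 hrat h𝔟 hss w hw𝔟 hw
  obtain ⟨D, hwD, hD𝔟⟩ := exists_tangent_le_of_hyperplane h L h₂ h₃ hCM κM hrat hw𝔟 hw
  have hbot : D.tangent = ⊥ := Submodule.finrank_eq_zero.mp (hss.finrank_eq_zero_of_le h𝔟 D hD𝔟)
  rw [hbot, Submodule.mem_bot] at hwD
  rw [hwD]
  exact zero_mem_ker L κM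

/-- **`semistabilityTheorem_std` is equivalent to its hyperplane case at all algebraic points**
(the hypothesis `hstd` of `AnalyticSubgroupHyperplane.lean`). [cite: BakerWustholz2007, Thm. 6.15, §6.7] -/
theorem semistabilityTheorem_std_iff_hyperplane :
    semistabilityTheorem_std ↔
      ∀ (L : PeriodPair), IsAlgebraic ℚ L.g₂ → IsAlgebraic ℚ L.g₃ → ¬ L.HasCM →
        ∀ (β γ δ : Type) [Fintype β] [Fintype γ] [Fintype δ] (κM : δ → γ → GaGmE.Kbar)
          (W : Submodule ℂ (β ⊕ (γ ⊕ δ) → ℂ)), LiePresentation.IsKRational GaGmE.Kbar W →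
          finrank ℂ W + 1 = Fintype.card (β ⊕ (γ ⊕ δ)) →
          (∀ 𝔨 ∈ GaGmE.Std.algLie κM, 𝔨 ≤ W → 𝔨 = ⊥) →
          ∀ w ∈ W, w ∈ GaGmE.Std.Alg L κM → w ∈ GaGmE.Std.ker L κM :=
  ⟨fun h => h.hyperplane, semistabilityTheorem_std_of_hyperplane⟩

/-- **Thm. 6.1 of Baker–Wüstholz for the `M_κ` from the named fact**: granted
`semistabilityTheorem_std`, every `w ∈ 𝔟_ℂ` (`𝔟` `ℚ̄`-rational) with `exp_{M_κ}(w)` algebraic lies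
in `Lie K ⊆ 𝔟` for a connected algebraic subgroup `K` of `M_κ`.
[cite: BakerWustholz2007, Thm. 6.1, Thm. 6.15] -/
theorem semistabilityTheorem_std.exists_tangent_le (h : semistabilityTheorem_std)
    (L : PeriodPair) (h₂ : IsAlgebraic ℚ L.g₂) (h₃ : IsAlgebraic ℚ L.g₃) (hCM : ¬ L.HasCM)
    {β γ δ : Type} [Fintype β] [Fintype γ] [Fintype δ] (κM : δ → γ → GaGmE.Kbar)
    {𝔟 : Submodule ℂ (β ⊕ (γ ⊕ δ) → ℂ)} (hrat : LiePresentation.IsKRational GaGmE.Kbar 𝔟)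
    {w : β ⊕ (γ ⊕ δ) → ℂ} (hw𝔟 : w ∈ 𝔟) (hw : w ∈ GaGmE.Std.Alg L κM) :
    ∃ D : GaGmE.Std.SubgroupData β γ δ κM, w ∈ D.tangent ∧ D.tangent ≤ 𝔟 :=
  GaGmE.Std.exists_tangent_le_of_hyperplane h.hyperplane L h₂ h₃ hCM κM hrat hw𝔟 hw

/-- **Wüstholz's analytic subgroup theorem (Baker–Wüstholz Thm. 6.1) for
`G = 𝔾ₐ × 𝔾ₘ^ι × (E♮)^κ` from the named fact**: granted `semistabilityTheorem_std`, every
`u ∈ 𝔟_ℂ` (`𝔟 ⊆ Lie G` `ℚ̄`-rational) with `exp_G(u)` algebraic lies in `Lie H ⊆ 𝔟` for a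
connected algebraic subgroup `H = H_{(A,C,Ξ)}` of `G` (`GaGmE.SubgroupData`) — through the
adapted coordinates `Φ : Lie G ≅ Lie M_κ` of `SemistableQuotients.QuotData` for `H₀ = 0`.
[cite: BakerWustholz2007, Thm. 6.1, Thm. 6.15, §6.8 (p. 115)] -/
theorem semistabilityTheorem_std.exists_tangent_le_GaGmE (h : semistabilityTheorem_std)
    (L : PeriodPair) (h₂ : IsAlgebraic ℚ L.g₂) (h₃ : IsAlgebraic ℚ L.g₃) (hCM : ¬ L.HasCM)
    {ι κ : Type} [Fintype ι] [Fintype κ] {𝔟 : Submodule ℂ (Unit ⊕ (ι ⊕ (κ ⊕ κ)) → ℂ)}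
    (hrat : LiePresentation.IsKRational GaGmE.Kbar 𝔟) {u : Unit ⊕ (ι ⊕ (κ ⊕ κ)) → ℂ}
    (hu𝔟 : u ∈ 𝔟) (hu : u ∈ GaGmE.Alg L ι κ) :
    ∃ D : GaGmE.SubgroupData ι κ, u ∈ D.tangent ∧ D.tangent ≤ 𝔟 := by
  classical
  obtain ⟨Q⟩ := GaGmE.nonempty_quotData (GaGmE.SubgroupData.bot : GaGmE.SubgroupData ι κ)
  have hbot : (GaGmE.SubgroupData.bot : GaGmE.SubgroupData ι κ).tangent ≤ 𝔟 := by
    rw [GaGmE.SubgroupData.tangent_bot]; exact bot_le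
  obtain ⟨D', huD', hD'⟩ := h.exists_tangent_le L h₂ h₃ hCM Q.κM (Q.isKRational_map hrat)
    (Submodule.mem_map_of_mem hu𝔟) (Q.Φ_mem_Alg h₂ h₃ hu)
  refine ⟨Q.pull D', ?_, ?_⟩
  · rw [← Q.comap_tangent, Submodule.mem_comap]; exact huD'
  · rw [← Q.comap_tangent, ← Q.comap_map hbot]; exact Submodule.comap_mono hD'

end Literature.NumberTheory.Transcendental

end
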